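/-
Copyright (c) 2026. All rights reserved.
Released under Apache 2.0 license as described in the file LICENSE.
Authors: HodgeCM publication cell (pub-hodgecm), GR lane, seat GR-2 (`pub-hodgecm-own-hyp34`).
-/
import Literature.NumberTheory.GelbartRogawski1991.Prop311PrintedDualPairLine
import Literature.NumberTheory.GelbartRogawski1991.CompatibleSplittingCM
import HarnessLib

-- build-lane note (ops-buildfix G11b-3 recipe): the statements below carry the dependent telescopes of the CM
-- dual-pair datum; elaborate sequentially (as the sibling `…ThetaKernelCM` files do).
set_option Elab.async false

/-!
# [GelbartRogawski1991, Prop. 3.1.1] AS PRINTED at CM data, from `GRConstruction.gru_shape` — modulo the comparison of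
# metaplectic models (`Mp` leg)

Topic `NumberTheory/GelbartRogawski1991`; namespace `Literature.NumberTheory.GelbartRogawski1991.Prop311`.
Definitions and proved lemmas only; nothing of [GelbartRogawski1991] is asserted; `Prop311AsPrinted` is untouched.

`GRConstruction.gru_shape` (`CompatibleSplittingCM.lean`) proves the record `SplittingDatum.CompatibleSplitting` of
[GelbartRogawski1991, Prop. 3.1.1 p. 455 L1–2] at every CM dual-pair datum `cmSplittingDatum L e dV … dW …` (diagonal
hermitian data over a CM field `L`, `F = L⁺`, big group `U(diag dV ⊗ diag dW)`, smooth model `adelicMpCont`).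
`Prop311PrintedDualPairLine.printed_conclusion_of_dualPairLine` turns a compatible splitting of the dual-pair datum with
LINE second factor (`T_V = T = diag(-2 d fᵢ)`, `T_W = 1`) into the printed proposition for a printed `(V, Φ)` in a
`Φ`-orthogonal frame, given the `Mp` comparison `φ`.  This file specialises to CM data:

* §1 `compatibleSplitting_splittingDatum_congr`: the record at `UnitaryDualPair.splittingDatum` only depends on the four
  matrices `(T_V, T_W, J_V, J_W)` (proof arguments irrelevant) — rewriting along matrix identities;
* §2 the CM line data `cmLineDV f i = (-2 d fᵢ) ∈ L` (`d = imagUnitSq L`, `δ = imagUnit L`): `realDiagonal = T`,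
  `diagonal = T ⊗ 1`, second factor `1`; **`compatibleSplitting_pairLineDatum_CM`**: `gru_shape` ⇒ the dual-pair datum
  with line second factor over `(L⁺, L, complexConj, imagUnit L)` has a compatible splitting, for every `f` with `fᵢ ≠ 0`;
* §3 **`printed_conclusion_CM`**: for printed data over `F = L⁺`, `E = L`, `σ` = complex conjugation — a skew-Hermitian
  `(V, Φ)`, a `Φ`-orthogonal frame with `Φ(bᵢ, bᵢ) = fᵢ δ`, `fᵢ ≠ 0`, a printed model `ρ` of `ρ_ψ` with THE splitting `i` —
  and a continuous homomorphism `φ : Mp_ψ(𝕎_𝐀)ᶜᵒⁿᵗ →* Mp_𝐀(W)` over `(frameSp b)⁻¹` (the model comparison, NOT supplied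
  here), clauses (1) and (2) of Prop. 3.1.1 hold VERBATIM as rendered in `Prop311AsPrinted`.

## References
* [GelbartRogawski1991] S. Gelbart, J. Rogawski, Invent. Math. 105 (1991) 445–472, §3.1 p. 454 L17–42, Prop. 3.1.1
  p. 455 L1–2.
* [Mok2014] C. P. Mok, Mem. AMS 235 (2015), §1 (unitary groups over CM fields).
-/

set_option autoImplicit false

noncomputable section

open NumberField
open scoped TensorProduct Matrix Kronecker
open Literature.NumberTheory.Automorphic
open Literature.NumberTheory.Automorphic.UnitaryGroup
open Literature.RepresentationTheory.HeisenbergGroup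
open Literature.NumberTheory.Weil1964

namespace Literature.NumberTheory.GelbartRogawski1991

/-! ## §1. The record at `UnitaryDualPair.splittingDatum` depends only on the matrices -/

namespace UnitaryDualPair

/-- **congruence**: `CompatibleSplitting` of `UnitaryDualPair.splittingDatum` along equalities of the four matrices
`T_V, T_W, J_V, J_W` (all proof arguments are irrelevant). [cite: GelbartRogawski1991, §3.1 Prop. 3.1.1 p. 455 L1–2] -/
theorem compatibleSplitting_splittingDatum_congr (F E : Type) [Field F] [NumberField F] [Field E] [NumberField E]
    [Algebra F E] [Algebra.IsQuadraticExtension F E] (c : E ≃ₐ[F] E) (N M : ℕ) {n : ℕ} (e : Fin N × Fin M ≃ Fin n)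
    {δ : E} (hcδ : c δ = -δ) (hδ : δ ≠ 0) {d : F} (hd : δ * δ = algebraMap F E d)
    {JV JV' : Matrix (Fin N) (Fin N) E} {JW JW' : Matrix (Fin M) (Fin M) E}
    {TV TV' : Matrix (Fin N) (Fin N) F} {TW TW' : Matrix (Fin M) (Fin M) F}
    (hV : TV.IsSymm) (hW : TW.IsSymm) (hVd : IsUnit TV.det) (hWd : IsUnit TW.det)
    (hJV : JV = TV.map (algebraMap F E)) (hJW : JW = TW.map (algebraMap F E))
    (hV' : TV'.IsSymm) (hW' : TW'.IsSymm) (hVd' : IsUnit TV'.det) (hWd' : IsUnit TW'.det)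
    (hJV' : JV' = TV'.map (algebraMap F E)) (hJW' : JW' = TW'.map (algebraMap F E))
    (eTV : TV' = TV) (eTW : TW' = TW) (eJV : JV' = JV) (eJW : JW' = JW) :
    (splittingDatum F E c N M e JV JW hcδ hδ hd hV hW hVd hWd hJV hJW).CompatibleSplitting ↔
      (splittingDatum F E c N M e JV' JW' hcδ hδ hd hV' hW' hVd' hWd' hJV' hJW').CompatibleSplitting := by
  subst eTV eTW eJV eJW
  exact Iff.rfl

end UnitaryDualPair

namespace Prop311

open UnitaryDualPair

variable (L : Type) [Field L] [NumberField L] [IsCMField L]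
variable {n : ℕ} (f : Fin n → ↥(maximalRealSubfield L))
variable (e : Fin n × Fin 1 ≃ Fin n) (he : ∀ k : Fin n, (e.symm k).1 = k)

/-! ## §2. The CM line data and `gru_shape` -/

section CMLine

/-- the diagonal hermitian data `dVᵢ = -2 d fᵢ ∈ L` (`d = imagUnitSq L`) of the CM frame — `σ`-fixed.
[cite: GelbartRogawski1991, §3.1 p. 454 L37–42] -/
def cmLineDV : Fin n → L := fun i =>
  algebraMap (↥(maximalRealSubfield L)) L (-2 * imagUnitSq L * f i)

/-- `dVᵢ` is fixed by complex conjugation. [cite: Mok2014, §1 Notation p. 5] -/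
theorem complexConj_cmLineDV (i : Fin n) : IsCMField.complexConj L (cmLineDV L f i) = cmLineDV L f i :=
  (IsCMField.complexConj L).commutes _

/-- `dVᵢ ≠ 0` when `fᵢ ≠ 0`. [cite: GelbartRogawski1991, §3.1 p. 454 L37–42] -/
theorem cmLineDV_ne_zero (hf0 : ∀ i, f i ≠ 0) (i : Fin n) : cmLineDV L f i ≠ 0 := by
  rw [cmLineDV, map_ne_zero]
  refine mul_ne_zero (mul_ne_zero (neg_ne_zero.2 two_ne_zero) ?_) (hf0 i)
  -- `d = δ² ≠ 0`
  intro h0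
  have h := imagUnit_mul_self L
  rw [h0, map_zero, mul_self_eq_zero] at h
  exact imagUnit_ne_zero L h

/-- at CM data `T = diag(-2 d fᵢ)` (`d = imagUnitSq L ≠ 0`) is invertible as soon as all `fᵢ ≠ 0` — the hypothesis `hT` of
the dual-pair line datum is automatic. [cite: GelbartRogawski1991, §3.1 p. 454 L17, L40–42] -/
theorem isUnit_det_cmLineGram (hf0 : ∀ i, f i ≠ 0) :
    IsUnit (symplecticGram (↥(maximalRealSubfield L)) (imagUnitSq L) f).det :=
  isUnit_det_symplecticGram (↥(maximalRealSubfield L)) f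
    (d_ne_zero (↥(maximalRealSubfield L)) L (imagUnit_ne_zero L) (imagUnit_mul_self L)) hf0

/-- `realDiagonal (dV) = T = diag(-2 d fᵢ)` over `L⁺`. [cite: GelbartRogawski1991, §3.1 p. 454 L37–42] -/
theorem realDiagonal_cmLineDV :
    realDiagonal L (cmLineDV L f) (complexConj_cmLineDV L f) =
      symplecticGram (↥(maximalRealSubfield L)) (imagUnitSq L) f := by
  ext i j
  rw [realDiagonal, symplecticGram]
  by_cases hij : i = j
  · subst hij
    rw [Matrix.diagonal_apply_eq, Matrix.diagonal_apply_eq]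
    rfl
  · rw [Matrix.diagonal_apply_ne _ hij, Matrix.diagonal_apply_ne _ hij]

/-- `diagonal (dV) = T ⊗ 1 ∈ M_N(L)`. [cite: GelbartRogawski1991, §3.1 p. 454 L37–42] -/
theorem diagonal_cmLineDV :
    Matrix.diagonal (cmLineDV L f) =
      (symplecticGram (↥(maximalRealSubfield L)) (imagUnitSq L) f).map (algebraMap (↥(maximalRealSubfield L)) L) := by
  rw [symplecticGram, Matrix.diagonal_map (map_zero _)]
  rfl

/-- the trivial second factor: `1 ∈ L` is conjugation-fixed. [cite: Mok2014, §1 Notation p. 5] -/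
theorem complexConj_one' (_i : Fin 1) : IsCMField.complexConj L ((fun _ : Fin 1 => (1 : L)) _i) = (fun _ : Fin 1 => (1 : L)) _i :=
  map_one _

/-- `realDiagonal (1) = 1`. [cite: GelbartRogawski1991, §3.1 p. 454 L37–42] -/
theorem realDiagonal_one : realDiagonal L (fun _ : Fin 1 => (1 : L)) (complexConj_one' L) = (1 : Matrix (Fin 1) (Fin 1) _) := by
  ext i j
  rw [realDiagonal]
  by_cases hij : i = j
  · subst hij
    rw [Matrix.diagonal_apply_eq, Matrix.one_apply_eq]
    rfl
  · rw [Matrix.diagonal_apply_ne _ hij, Matrix.one_apply_ne hij]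

/-- **`gru_shape` ⇒ the dual-pair datum with line second factor over `(L⁺, L, complexConj, imagUnit L)` has a compatible
splitting**, for every frame parameter `f` with `fᵢ ≠ 0`. [cite: GelbartRogawski1991, §3.1 Prop. 3.1.1 p. 455 L1–2] -/
theorem compatibleSplitting_pairLineDatum_CM (hf0 : ∀ i, f i ≠ 0)
    (hT : IsUnit (symplecticGram (↥(maximalRealSubfield L)) (imagUnitSq L) f).det) :
    (pairLineDatum (↥(maximalRealSubfield L)) L (IsCMField.complexConj L) (complexConj_imagUnit L) (imagUnit_ne_zero L)
      (imagUnit_mul_self L) f e hT).CompatibleSplitting :=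
  (compatibleSplitting_splittingDatum_congr (↥(maximalRealSubfield L)) L (IsCMField.complexConj L) n 1 e
    (complexConj_imagUnit L) (imagUnit_ne_zero L) (imagUnit_mul_self L)
    (realDiagonal_isSymm L (cmLineDV L f) (complexConj_cmLineDV L f))
    (realDiagonal_isSymm L (fun _ : Fin 1 => (1 : L)) (complexConj_one' L))
    (isUnit_det_realDiagonal L (cmLineDV L f) (complexConj_cmLineDV L f) (cmLineDV_ne_zero L f hf0))
    (isUnit_det_realDiagonal L (fun _ : Fin 1 => (1 : L)) (complexConj_one' L) (fun _ => one_ne_zero))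
    (realDiagonal_map L (cmLineDV L f) (complexConj_cmLineDV L f)).symm
    (realDiagonal_map L (fun _ : Fin 1 => (1 : L)) (complexConj_one' L)).symm
    (isSymm_symplecticGram (↥(maximalRealSubfield L)) (imagUnitSq L) f) Matrix.isSymm_one hT
    (by rw [Matrix.det_one]; exact isUnit_one) rfl (one_eq_map_one (↥(maximalRealSubfield L)) L)
    (realDiagonal_cmLineDV L f).symm (realDiagonal_one L).symm (diagonal_cmLineDV L f).symm
    Matrix.diagonal_one.symm).1
    (GRConstruction.compatibleSplitting_cmSplittingDatum L e (cmLineDV L f) (complexConj_cmLineDV L f)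
      (cmLineDV_ne_zero L f hf0) (fun _ : Fin 1 => (1 : L)) (complexConj_one' L) (fun _ => one_ne_zero))

end CMLine

/-! ## §3. The printed proposition at CM data -/

section Printed

-- `V` is an `L`-space; its `L⁺`-structure and `IsScalarTower L⁺ L V` are Mathlib's restriction instances (no extra binder:
-- an independent `[Module L⁺ V]` would be a second, unrelated scalar action).
variable (V : Type) [AddCommGroup V] [Module L V]
variable (b : Module.Basis (Fin n) L V) (Φ : V →ₗ[↥(maximalRealSubfield L)] V →ₗ[↥(maximalRealSubfield L)] L)
variable {S : Type} [NormedAddCommGroup S] [InnerProductSpace ℂ S]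
variable (ρ : Representation ℂ (AdelicHeisenberg (↥(maximalRealSubfield L)) L V Φ) S)
variable (i : ratSp (↥(maximalRealSubfield L)) L V Φ →* adelicMp (↥(maximalRealSubfield L)) L V Φ ρ)
variable (hi : IsRationalSplitting (↥(maximalRealSubfield L)) L V Φ ρ i)

include hi he in
/-- **[GelbartRogawski1991, Prop. 3.1.1] AS PRINTED AT CM DATA, modulo the `Mp` comparison.**  Let `L` be a CM field,
`F = L⁺`, `σ` the complex conjugation, `(V, Φ)` a skew-Hermitian space over `L` (printed axioms), `b` a `Φ`-orthogonal
`L`-basis with `Φ(bᵢ, bᵢ) = fᵢ δ` (`δ = imagUnit L`), `fᵢ ≠ 0`, `ρ` a printed model of `ρ_ψ` with THE rational splitting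
`i`.  Then every continuous homomorphism `φ` from the smooth metaplectic model `Mp_ψ(𝕎_𝐀)ᶜᵒⁿᵗ` (Gram matrix `T ⊗ 1`,
`T = diag(-2 d fᵢ)`) to the printed `Mp_𝐀(W)` lying over `(frameSp b)⁻¹` yields clauses (1) and (2) of Prop. 3.1.1 for
`(V, Φ, ρ, i)`, verbatim as rendered in `Prop311AsPrinted` — the compatible splitting being `GRConstruction.gru_shape`'s.
[cite: GelbartRogawski1991, §3.1 p. 454 L17–42; Prop. 3.1.1 p. 455 L1–2] -/
theorem printed_conclusion_CM
    (hΦ₁ : ∀ (a : L) (x y : V), Φ (a • x) y = a * Φ x y)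
    (hΦ₂ : ∀ (a : L) (x y : V), Φ x (a • y) = Φ x y * IsCMField.complexConj L a)
    (hb : ∀ i j, i ≠ j → Φ (b i) (b j) = 0)
    (hf : ∀ i, Φ (b i) (b i) = algebraMap (↥(maximalRealSubfield L)) L (f i) * imagUnit L) (hf0 : ∀ i, f i ≠ 0)
    (hi! : ∀ i' : ratSp (↥(maximalRealSubfield L)) L V Φ →* adelicMp (↥(maximalRealSubfield L)) L V Φ ρ,
      IsRationalSplitting (↥(maximalRealSubfield L)) L V Φ ρ i' → i' = i)
    (φ : adelicMpCont (↥(maximalRealSubfield L)) (Fin n)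
        (adelicGram (↥(maximalRealSubfield L)) e (symplecticGram (↥(maximalRealSubfield L)) (imagUnitSq L) f)
          (1 : Matrix (Fin 1) (Fin 1) (↥(maximalRealSubfield L)))) →*
      adelicMp (↥(maximalRealSubfield L)) L V Φ ρ) (hφ : Continuous φ)
    (hproj : ∀ m,
      frameConj (↥(maximalRealSubfield L)) L (IsCMField.complexConj L) (complexConj_imagUnit L) (imagUnit_ne_zero L)
          (imagUnit_mul_self L) V b
          ((proj (↥(maximalRealSubfield L)) L V Φ ρ (φ m) : adelicSp (↥(maximalRealSubfield L)) L V Φ) :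
            AdelicSpace (↥(maximalRealSubfield L)) V ≃ₗ[AdeleRing (𝓞 ↥(maximalRealSubfield L)) ↥(maximalRealSubfield L)]
              AdelicSpace (↥(maximalRealSubfield L)) V) =
        ((adelicMpCont.proj (↥(maximalRealSubfield L)) (Fin n)
            (adelicGram (↥(maximalRealSubfield L)) e (symplecticGram (↥(maximalRealSubfield L)) (imagUnitSq L) f)
              (1 : Matrix (Fin 1) (Fin 1) (↥(maximalRealSubfield L)))) m :
            symplecticGroup (polar (adelicForm (↥(maximalRealSubfield L)) (Fin n)
              (adelicGram (↥(maximalRealSubfield L)) e (symplecticGram (↥(maximalRealSubfield L)) (imagUnitSq L) f)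
                (1 : Matrix (Fin 1) (Fin 1) (↥(maximalRealSubfield L))))))) :
          ((Fin n → AdeleRing (𝓞 ↥(maximalRealSubfield L)) ↥(maximalRealSubfield L)) ×
              (Fin n → AdeleRing (𝓞 ↥(maximalRealSubfield L)) ↥(maximalRealSubfield L))) ≃ₗ[
              AdeleRing (𝓞 ↥(maximalRealSubfield L)) ↥(maximalRealSubfield L)]
            ((Fin n → AdeleRing (𝓞 ↥(maximalRealSubfield L)) ↥(maximalRealSubfield L)) ×
              (Fin n → AdeleRing (𝓞 ↥(maximalRealSubfield L)) ↥(maximalRealSubfield L))))) :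
    (∃ s : adelicUnitary (↥(maximalRealSubfield L)) L V Φ →* adelicMp (↥(maximalRealSubfield L)) L V Φ ρ,
        ∀ g : adelicUnitary (↥(maximalRealSubfield L)) L V Φ,
          projEnd (↥(maximalRealSubfield L)) L V Φ ρ (s g) =
            ((g : AdelicSpace (↥(maximalRealSubfield L)) V ≃ₗ[AdeleRing (𝓞 ↥(maximalRealSubfield L)) ↥(maximalRealSubfield L)]
                AdelicSpace (↥(maximalRealSubfield L)) V) :
              AdelicSpace (↥(maximalRealSubfield L)) V →ₗ[AdeleRing (𝓞 ↥(maximalRealSubfield L)) ↥(maximalRealSubfield L)]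
                AdelicSpace (↥(maximalRealSubfield L)) V)) ∧
      ∃ s : adelicUnitary (↥(maximalRealSubfield L)) L V Φ →* adelicMp (↥(maximalRealSubfield L)) L V Φ ρ,
        Continuous s ∧
        (∀ g : adelicUnitary (↥(maximalRealSubfield L)) L V Φ,
          projEnd (↥(maximalRealSubfield L)) L V Φ ρ (s g) =
            ((g : AdelicSpace (↥(maximalRealSubfield L)) V ≃ₗ[AdeleRing (𝓞 ↥(maximalRealSubfield L)) ↥(maximalRealSubfield L)]
                AdelicSpace (↥(maximalRealSubfield L)) V) :
              AdelicSpace (↥(maximalRealSubfield L)) V →ₗ[AdeleRing (𝓞 ↥(maximalRealSubfield L)) ↥(maximalRealSubfield L)]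
                AdelicSpace (↥(maximalRealSubfield L)) V)) ∧
        ∀ g : adelicUnitary (↥(maximalRealSubfield L)) L V Φ,
          IsRationalPoint (↥(maximalRealSubfield L)) L V Φ
              (g : AdelicSpace (↥(maximalRealSubfield L)) V ≃ₗ[AdeleRing (𝓞 ↥(maximalRealSubfield L)) ↥(maximalRealSubfield L)]
                AdelicSpace (↥(maximalRealSubfield L)) V) →
            s g ∈ i.range :=
  printed_conclusion_of_dualPairLine (↥(maximalRealSubfield L)) L (IsCMField.complexConj L) (complexConj_imagUnit L)
    (imagUnit_ne_zero L) (imagUnit_mul_self L) V b Φ f e he ρ i hi hΦ₁ hΦ₂ hb hf hf0 hi! (isUnit_det_cmLineGram L f hf0)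
    φ hφ hproj (compatibleSplitting_pairLineDatum_CM L f e hf0 (isUnit_det_cmLineGram L f hf0))

end Printed

end Prop311

end Literature.NumberTheory.GelbartRogawski1991

end
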